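import Summits.QuantumFields.YangMills.Theorems.BalabanUVNodesN08HaarCompatibilityGuardHybridNearBlocks
import Summits.QuantumFields.YangMills.Theorems.BalabanUVNodesN08HaarCompatibilityGuardHybridCovariance

/-!
# BalabanUVNodes ∕ N08 — AN ISOLATED GUARDED BOND LEAVES NO TRACE AT THE NEXT LEVEL: below the top level, for every gauge-invariant density `ρ ≥ 0` reading only the end
# blocks of `c`, the guarded part `ρ·1_{G_c}·dU` is transported by the hybrid averaging `Ū^{{c}}` to EXACTLY `(∫_{G_c} ρ dU) • dV` — a CONSTANT density; in particular
# `(dU↾G_c)∘(Ū^{{c}})⁻¹ = dU(G_c) • dV`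

WIDTH SEAT `pub-ymgap-dag-n08-w3` g7, item-3 lineage PART 38B (successor of parts 35 `…GuardHybridFresh` (product form), 37 `…GuardHybridNearBlocks` (canonical far set) and 38A
`…GuardHybridCovariance` (one-coordinate law `mass • Haar`, near({c}) = {c})), 2026-08-28.  Track A, DAG node N08 = [Balaban1985UV3] Thm 1 p. 257 (compact) + Thm 2 p. 272; key item
K1⁷ `StabilityBAtRecordR13SepCoPH` (stmt-QuantumFields-20542), `--supports … --as helper`.  COUNT-NEUTRAL.

THE POINT (located; road (ii) bookkeeping for the floored Haar iterate, n08-w1 g6 `N08-NO-STACKING-MECHANISM.md` §3; count-neutral).  In the positive polymer bound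
`μ∘Ū⁻¹ ≤ Σ_S (μ↾G_S)∘(Ū^S)⁻¹` (part 34) the SINGLETON polymers `S = {c}` are the leading terms (activity `q`, not `q²`).  This file shows they are HARMLESS: below the top
level (`j + 1 < m + K`) and for any gauge-invariant non-negative integrable density `ρ` reading only the bonds issuing from `B(c₋) ∪ B(c₊)`,
  **`((ρ·1_{G_c})·dU)∘(Ū^{{c}})⁻¹ = (∫ ρ·1_{G_c} dU) • dV`**   (§2 `map_withDensity_guard_hybrid_singleton_eq_smul`),
i.e. the transported singleton-guarded part has CONSTANT density equal to its mass: by part 35 its far coordinates (every bond other than `c`, parts 37 + 38A §4) are fresh Haar, and by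
part 38A §3 its single near coordinate `Ū(c)` is Haar too (coarse-gauge invariance at `c₋`, `c₊`).  Special case `ρ ≡ 1` (§2 `map_restrict_guard_hybrid_singleton`): **the isolated guard
of print's own reference measure is invisible after one step** — `(dU↾G_c)∘(Ū^{{c}})⁻¹ = dU(G_c) • dV`.  So after one step the density excess of the floored iterate is carried
ENTIRELY by polymers with `|S| ≥ 2` sharing an end block (activity `≤ q²` per block pair); the `|S| = 1` terms contribute the constant `Σ_c dU(G_c)` to the mean and nothing to the shape.

* §1 `mem_blocks_singleton_iff` (`Blk({c}) = {c₋, c₊}`), `nearIndex_eq` (below the top level the near index type of the canonical far set of `{c}` is the singleton `{c}`).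
* §2 ★★★ `map_withDensity_guard_hybrid_singleton_eq_smul`, ★★ `map_restrict_guard_hybrid_singleton` (`ρ ≡ 1`).
* §3 the same at the [B10] slot's averaging `avOfPrint N S₀ j` on `SU(N)`, every `N` (`j + 1 < m + K`).

HONEST FRAMING.  [folklore] measure theory over parts 34∕35∕37∕38A BY IMPORT; nothing of Bałaban's asserted; an EXACT identity for singleton polymers only — no bound for `|S| ≥ 2`, no
cluster expansion, no k-uniform `hmass`; E6′ NOT decided; N08 NOT discharged; counts unmoved (typed 28∕28 · discharged 5∕27); one finite 𝕋⁴ programme at fixed ε — R4 closes the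
CONDITIONAL rung `BalabanLadder.UV` only; the Yang–Mills mass gap (Clay) is NOT proved by any of this; nothing continuum ∕ ℝ⁴ ∕ OS.  0 `sorry`, 0 `def`, 0 `instance`, standard axioms.
-/

noncomputable section

open MeasureTheory
open scoped ENNReal

namespace Summit.QuantumFields.YangMills.BalabanUVNodes.N08HaarCompatibilityGuardHybridIsolatedGuard

open Literature.MathematicalPhysics.QuantumFieldTheory.Balaban1983to89
open Literature.MathematicalPhysics.QuantumFieldTheory.Balaban1983to89.AveragingRT (axialAvg measurable_axialAvg line)
open Literature.MathematicalPhysics.QuantumFieldTheory.Balaban1983to89.BlockAveraging (Small avgFun measurable_avgFun)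
open Literature.MathematicalPhysics.QuantumFieldTheory.Balaban1983to89.B12RTGaugeInvariance254 (measurable_gaugeAct)
open Summit.QuantumFields.Balaban3D.Proofs
open Summit.QuantumFields.YangMills.BalabanUVNodes.N08HaarCompatibilityGuardHybridPartition (measurable_hybrid measurableSet_guardAll)
open Summit.QuantumFields.YangMills.BalabanUVNodes.N08HaarCompatibilityGuardHybridFresh (map_withDensity_hybrid_split_eq_prod splitEquiv_fst_apply)
open Summit.QuantumFields.YangMills.BalabanUVNodes.N08HaarCompatibilityGuardHybridNearBlocks
  (canonical_tau_lt canonical_far_spec not_canonicalFar_iff not_canonicalFar_of_mem localOff_of_blockLocal blockLocal_mul_guardAll_indicator)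
open Summit.QuantumFields.YangMills.BalabanUVNodes.N08HaarCompatibilityGuardHybridCovariance
  (map_gaugeAct_withDensity_of_gaugeInvariant gaugeInvariant_mul_guardAll_indicator map_apply_hybrid_eq_mass_smul_haar eq_of_src_mem_of_tgt_mem)

/-! ## §1 Geometry of the singleton polymer -/

section Geometry

variable {P : Params} {j : ℕ} [DecidableEq (PBond P (j + 1))]

omit [DecidableEq (PBond P (j + 1))] in
/-- `Blk({c}) = {c₋, c₊}`. [folklore] -/
theorem mem_blocks_singleton_iff (c : PBond P (j + 1)) (x : Site P (j + 1)) :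
    x ∈ ({c} : Finset (PBond P (j + 1))).image PBond.src ∪ ({c} : Finset (PBond P (j + 1))).image PBond.tgt ↔ x = c.src ∨ x = c.tgt := by
  simp only [Finset.mem_union, Finset.mem_image, Finset.mem_singleton, exists_eq_left]
  exact ⟨fun h => h.elim (fun h => Or.inl h.symm) (fun h => Or.inr h.symm), fun h => h.elim (fun h => Or.inl h.symm) (fun h => Or.inr h.symm)⟩

omit [DecidableEq (PBond P (j + 1))] in
/-- **BELOW THE TOP LEVEL THE NEAR SET OF THE SINGLETON POLYMER IS `{c}`**: every bond that is not canonically far from `{c}` (both end points in `{c₋, c₊}`) is `c` (part 38A §4).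
[cite: Balaban1987RG1, (0.1) p.251 (bookkeeping)] -/
theorem nearIndex_eq (h : j + 1 < P.m + P.K) (c : PBond P (j + 1)) {c' : PBond P (j + 1)}
    (hc' : ¬ (c'.src ∉ ({c} : Finset (PBond P (j + 1))).image PBond.src ∪ ({c} : Finset (PBond P (j + 1))).image PBond.tgt ∨
      c'.tgt ∉ ({c} : Finset (PBond P (j + 1))).image PBond.src ∪ ({c} : Finset (PBond P (j + 1))).image PBond.tgt)) :
    c' = c := by
  rw [not_canonicalFar_iff, mem_blocks_singleton_iff, mem_blocks_singleton_iff] at hc'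
  exact eq_of_src_mem_of_tgt_mem h hc'.1 hc'.2

end Geometry

/-! ## §2 The transported singleton-guarded part is its mass times `dV` -/

section Isolated

variable {P : Params} {j : ℕ} {G : Type} [GaugeGroup G] (ℰ : LoopAverage G) [DecidableEq (PBond P (j + 1))] [MeasurableSpace G] [RegularGaugeGroup G] [HaarData G]

/-- ★★★ **AN ISOLATED GUARDED BOND LEAVES NO TRACE AT THE NEXT LEVEL.**  Below the top level (`j + 1 < m + K`), for every measurable small-loop average `ℰ`, every coarse bond `c`
and every gauge-invariant, non-negative, measurable, integrable density `ρ` reading only the bonds issuing from `B(c₋) ∪ B(c₊)`: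
**`((ρ·1_{G_c})·dU)∘(Ū^{{c}})⁻¹ = (∫ ρ·1_{G_c} dU) • dV`**, `G_c = {Small ℰ · c}`, `Ū^{{c}}` the hybrid averaging (typed (0.4) at `c`, axial elsewhere) — the transported
singleton-guarded part has CONSTANT density.  Mechanism: part 35's product form with part 37's canonical far set (all bonds but `c` are far: part 38A §4), and part 38A §3 (the law of
the single near coordinate under a gauge-invariant input is `mass • Haar`). [cite: Balaban1987RG1, (2.1) p.265 + (0.4) p.253; Balaban1985UV3, (10) p.258 + (48)–(49) p.268; Balaban1985Averaging, (11)+(15) p.19 (bookkeeping — the identity is NOT in print)] -/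
theorem map_withDensity_guard_hybrid_singleton_eq_smul (hlt : j + 1 < P.m + P.K) (hE : ∀ n, Measurable fun W : Fin (n + 1) → G => ℰ.E W) (c : PBond P (j + 1))
    (ρ : Density P j G) (hρm : Measurable ρ) (hρ0 : ∀ W, 0 ≤ ρ W) (hρ : Integrable ρ (fieldMeasure P j G)) (hρinv : GaugeField.GaugeInvariant ρ)
    (hloc : ∀ W W' : GaugeField P j G,
      (∀ b : PBond P j, blockOf b.src ∈ ({c} : Finset (PBond P (j + 1))).image PBond.src ∪ ({c} : Finset (PBond P (j + 1))).image PBond.tgt → W b = W' b) → ρ W = ρ W') :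
    ((fieldMeasure P j G).withDensity fun U => ENNReal.ofReal
        (ρ U * {W : GaugeField P j G | ∀ c' ∈ ({c} : Finset (PBond P (j + 1))), Small ℰ W c'}.indicator (fun _ => (1 : ℝ)) U)).map
        (fun U => (fun c' => if c' ∈ ({c} : Finset (PBond P (j + 1))) then avgFun ℰ U c' else axialAvg U c' : GaugeField P (j + 1) G)) =
      ENNReal.ofReal (∫ U, ρ U * {W : GaugeField P j G | ∀ c' ∈ ({c} : Finset (PBond P (j + 1))), Small ℰ W c'}.indicator (fun _ => (1 : ℝ)) U ∂(fieldMeasure P j G)) •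
        fieldMeasure P (j + 1) G := by
  haveI := HaarData.isProb (G := G)
  have hj : j + 1 ≤ P.m + P.K := hlt.le
  -- the singleton-guarded density `ρ' = ρ·1_{G_c}`: measurable, non-negative, integrable, gauge invariant, reading only `B(c₋) ∪ B(c₊)`
  have hρ'm : Measurable fun U : GaugeField P j G =>
      ρ U * {W : GaugeField P j G | ∀ c' ∈ ({c} : Finset (PBond P (j + 1))), Small ℰ W c'}.indicator (fun _ => (1 : ℝ)) U :=
    hρm.mul (measurable_const.indicator (measurableSet_guardAll ℰ _))
  have hρ'0 : ∀ W : GaugeField P j G, 0 ≤ ρ W * {W : GaugeField P j G | ∀ c' ∈ ({c} : Finset (PBond P (j + 1))), Small ℰ W c'}.indicator (fun _ => (1 : ℝ)) W :=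
    fun W => mul_nonneg (hρ0 W) (Set.indicator_nonneg (fun _ _ => zero_le_one) W)
  have hρ' : Integrable (fun U : GaugeField P j G =>
      ρ U * {W : GaugeField P j G | ∀ c' ∈ ({c} : Finset (PBond P (j + 1))), Small ℰ W c'}.indicator (fun _ => (1 : ℝ)) U) (fieldMeasure P j G) :=
    hρ.mul_bdd ((measurable_const.indicator (measurableSet_guardAll ℰ _)).aestronglyMeasurable) (c := 1)
      (Filter.Eventually.of_forall fun U => by
        by_cases hU : U ∈ {W : GaugeField P j G | ∀ c' ∈ ({c} : Finset (PBond P (j + 1))), Small ℰ W c'}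
        · rw [Set.indicator_of_mem hU]; simp
        · rw [Set.indicator_of_notMem hU]; simp)
  have hρ'inv := gaugeInvariant_mul_guardAll_indicator ℰ ({c} : Finset (PBond P (j + 1))) hρinv
  have hρ'loc := blockLocal_mul_guardAll_indicator ℰ hj ({c} : Finset (PBond P (j + 1))) ρ hloc
  -- abbreviations AFTER the facts above (so that they are rewritten too)
  set ρ' : GaugeField P j G → ℝ := fun U =>
    ρ U * {W : GaugeField P j G | ∀ c' ∈ ({c} : Finset (PBond P (j + 1))), Small ℰ W c'}.indicator (fun _ => (1 : ℝ)) U with hρ'def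
  set μρ : Measure (GaugeField P j G) := (fieldMeasure P j G).withDensity fun U => ENNReal.ofReal (ρ' U) with hμρ
  haveI hfin : IsFiniteMeasure μρ := by
    refine ⟨?_⟩
    rw [hμρ, withDensity_apply _ MeasurableSet.univ, Measure.restrict_univ]
    exact (lintegral_ofReal_le_lintegral_enorm ρ').trans_lt hρ'.2
  have hμinv : ∀ u : GaugeTransf P j G, μρ.map (GaugeField.gaugeAct u) = μρ := fun u => map_gaugeAct_withDensity_of_gaugeInvariant hρ'm hρ'inv u
  -- the canonical far set of `{c}` and the instance for its selected bonds
  haveI : DecidablePred fun b : PBond P j => ∃ c' : PBond P (j + 1),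
      (c'.src ∉ ({c} : Finset (PBond P (j + 1))).image PBond.src ∪ ({c} : Finset (PBond P (j + 1))).image PBond.tgt ∨
        c'.tgt ∉ ({c} : Finset (PBond P (j + 1))).image PBond.src ∪ ({c} : Finset (PBond P (j + 1))).image PBond.tgt) ∧
        line c' (if c'.src ∉ ({c} : Finset (PBond P (j + 1))).image PBond.src ∪ ({c} : Finset (PBond P (j + 1))).image PBond.tgt then 0 else P.L - 1) = b :=
    Classical.decPred _
  -- part 35's product form at the canonical far set
  have hprod := map_withDensity_hybrid_split_eq_prod ℰ hj hE ({c} : Finset (PBond P (j + 1)))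
    (fun c' : PBond P (j + 1) => c'.src ∉ ({c} : Finset (PBond P (j + 1))).image PBond.src ∪ ({c} : Finset (PBond P (j + 1))).image PBond.tgt ∨
      c'.tgt ∉ ({c} : Finset (PBond P (j + 1))).image PBond.src ∪ ({c} : Finset (PBond P (j + 1))).image PBond.tgt)
    (fun c' : PBond P (j + 1) => if c'.src ∉ ({c} : Finset (PBond P (j + 1))).image PBond.src ∪ ({c} : Finset (PBond P (j + 1))).image PBond.tgt then 0 else P.L - 1)
    (fun c' _ => canonical_tau_lt _ c') (canonical_far_spec hj _) ρ' hρ'0 hρ' (localOff_of_blockLocal hj _ ρ' hρ'loc)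
  -- the near index type is the singleton `{c}`
  have h0 : ¬ (c.src ∉ ({c} : Finset (PBond P (j + 1))).image PBond.src ∪ ({c} : Finset (PBond P (j + 1))).image PBond.tgt ∨
      c.tgt ∉ ({c} : Finset (PBond P (j + 1))).image PBond.src ∪ ({c} : Finset (PBond P (j + 1))).image PBond.tgt) :=
    not_canonicalFar_of_mem _ (Finset.mem_singleton_self c)
  letI hU : Unique {c' : PBond P (j + 1) // ¬ (c'.src ∉ ({c} : Finset (PBond P (j + 1))).image PBond.src ∪ ({c} : Finset (PBond P (j + 1))).image PBond.tgt ∨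
      c'.tgt ∉ ({c} : Finset (PBond P (j + 1))).image PBond.src ∪ ({c} : Finset (PBond P (j + 1))).image PBond.tgt)} :=
    { default := ⟨c, h0⟩, uniq := fun x => Subtype.ext (nearIndex_eq hlt c x.2) }
  -- the near marginal is `m • Haar^{near}`, `m = μρ(univ)`: compare both through the evaluation at the unique near index
  have hfu := (MeasureTheory.measurePreserving_funUnique (HaarData.haar : Measure G)
    {c' : PBond P (j + 1) // ¬ (c'.src ∉ ({c} : Finset (PBond P (j + 1))).image PBond.src ∪ ({c} : Finset (PBond P (j + 1))).image PBond.tgt ∨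
      c'.tgt ∉ ({c} : Finset (PBond P (j + 1))).image PBond.src ∪ ({c} : Finset (PBond P (j + 1))).image PBond.tgt)}).map_eq
  set e := MeasurableEquiv.funUnique
    {c' : PBond P (j + 1) // ¬ (c'.src ∉ ({c} : Finset (PBond P (j + 1))).image PBond.src ∪ ({c} : Finset (PBond P (j + 1))).image PBond.tgt ∨
      c'.tgt ∉ ({c} : Finset (PBond P (j + 1))).image PBond.src ∪ ({c} : Finset (PBond P (j + 1))).image PBond.tgt)} G with he
  have he_apply : ∀ w, e w = w ⟨c, h0⟩ := fun w => rfl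
  have hHm : Measurable fun U : GaugeField P j G =>
      (fun c' => if c' ∈ ({c} : Finset (PBond P (j + 1))) then avgFun ℰ U c' else axialAvg U c' : GaugeField P (j + 1) G) := measurable_hybrid ℰ hE _
  have hΦ1m : Measurable fun U : GaugeField P j G => (FibreSplit.splitEquiv
      (fun c' : PBond P (j + 1) => c'.src ∉ ({c} : Finset (PBond P (j + 1))).image PBond.src ∪ ({c} : Finset (PBond P (j + 1))).image PBond.tgt ∨
        c'.tgt ∉ ({c} : Finset (PBond P (j + 1))).image PBond.src ∪ ({c} : Finset (PBond P (j + 1))).image PBond.tgt) (P := P) (G := G)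
      (fun c' => if c' ∈ ({c} : Finset (PBond P (j + 1))) then avgFun ℰ U c' else axialAvg U c')).1 :=
    measurable_fst.comp ((FibreSplit.splitEquiv _ (P := P) (G := G)).measurable.comp hHm)
  have hnear : μρ.map (fun U : GaugeField P j G => (FibreSplit.splitEquiv
      (fun c' : PBond P (j + 1) => c'.src ∉ ({c} : Finset (PBond P (j + 1))).image PBond.src ∪ ({c} : Finset (PBond P (j + 1))).image PBond.tgt ∨
        c'.tgt ∉ ({c} : Finset (PBond P (j + 1))).image PBond.src ∪ ({c} : Finset (PBond P (j + 1))).image PBond.tgt) (P := P) (G := G)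
      (fun c' => if c' ∈ ({c} : Finset (PBond P (j + 1))) then avgFun ℰ U c' else axialAvg U c')).1) =
      μρ Set.univ • Measure.pi (fun _ => (HaarData.haar : Measure G)) := by
    -- both sides have the same image under the measurable equivalence `e` (evaluation at the near index `c`)
    have h1 : (μρ.map (fun U : GaugeField P j G => (FibreSplit.splitEquiv
        (fun c' : PBond P (j + 1) => c'.src ∉ ({c} : Finset (PBond P (j + 1))).image PBond.src ∪ ({c} : Finset (PBond P (j + 1))).image PBond.tgt ∨
          c'.tgt ∉ ({c} : Finset (PBond P (j + 1))).image PBond.src ∪ ({c} : Finset (PBond P (j + 1))).image PBond.tgt) (P := P) (G := G)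
        (fun c' => if c' ∈ ({c} : Finset (PBond P (j + 1))) then avgFun ℰ U c' else axialAvg U c')).1)).map e =
        μρ.map (fun U : GaugeField P j G => (if c ∈ ({c} : Finset (PBond P (j + 1))) then avgFun ℰ U c else axialAvg U c)) := by
      rw [Measure.map_map e.measurable hΦ1m]
      exact Measure.map_congr (Filter.Eventually.of_forall fun U => he_apply _)
    have h2 : μρ.map (fun U : GaugeField P j G => (if c ∈ ({c} : Finset (PBond P (j + 1))) then avgFun ℰ U c else axialAvg U c)) =
        μρ Set.univ • (HaarData.haar : Measure G) := map_apply_hybrid_eq_mass_smul_haar ℰ hj hE _ μρ hμinv c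
    have h3 : (μρ Set.univ • Measure.pi (fun _ => (HaarData.haar : Measure G))).map e = μρ Set.univ • (HaarData.haar : Measure G) := by
      rw [Measure.map_smul]
      congr 1
      convert hfu using 3
    calc μρ.map _ = ((μρ.map _).map e).map e.symm := (MeasurableEquiv.map_symm_map e).symm
      _ = ((μρ Set.univ • Measure.pi (fun _ => (HaarData.haar : Measure G))).map e).map e.symm := by rw [h1, h2, ← h3]
      _ = _ := MeasurableEquiv.map_symm_map e
  -- assemble: the image under `split ∘ Ū^{{c}}` is `m • (Haar^{near} ⊗ Haar^{far}) = m • dV∘split⁻¹`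
  have hsplit := (FibreSplit.measurePreserving_split
    (fun c' : PBond P (j + 1) => c'.src ∉ ({c} : Finset (PBond P (j + 1))).image PBond.src ∪ ({c} : Finset (PBond P (j + 1))).image PBond.tgt ∨
      c'.tgt ∉ ({c} : Finset (PBond P (j + 1))).image PBond.src ∪ ({c} : Finset (PBond P (j + 1))).image PBond.tgt) (P := P) (j := j + 1) (G := G)).map_eq
  have himage : (μρ.map (fun U : GaugeField P j G =>
      (fun c' => if c' ∈ ({c} : Finset (PBond P (j + 1))) then avgFun ℰ U c' else axialAvg U c' : GaugeField P (j + 1) G))).map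
        (FibreSplit.splitEquiv
          (fun c' : PBond P (j + 1) => c'.src ∉ ({c} : Finset (PBond P (j + 1))).image PBond.src ∪ ({c} : Finset (PBond P (j + 1))).image PBond.tgt ∨
            c'.tgt ∉ ({c} : Finset (PBond P (j + 1))).image PBond.src ∪ ({c} : Finset (PBond P (j + 1))).image PBond.tgt) (P := P) (G := G)) =
      (μρ Set.univ • fieldMeasure P (j + 1) G).map
        (FibreSplit.splitEquiv
          (fun c' : PBond P (j + 1) => c'.src ∉ ({c} : Finset (PBond P (j + 1))).image PBond.src ∪ ({c} : Finset (PBond P (j + 1))).image PBond.tgt ∨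
            c'.tgt ∉ ({c} : Finset (PBond P (j + 1))).image PBond.src ∪ ({c} : Finset (PBond P (j + 1))).image PBond.tgt) (P := P) (G := G)) := by
    rw [Measure.map_smul, hsplit, ← Measure.prod_smul_left, ← hnear]
    calc _ = μρ.map (fun U : GaugeField P j G => FibreSplit.splitEquiv _ (P := P) (G := G)
          (fun c' => if c' ∈ ({c} : Finset (PBond P (j + 1))) then avgFun ℰ U c' else axialAvg U c')) :=
          Measure.map_map (FibreSplit.splitEquiv _ (P := P) (G := G)).measurable hHm
      _ = _ := hprod
  -- undo the splitting and identify the mass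
  have hmass : μρ Set.univ = ENNReal.ofReal (∫ U, ρ' U ∂(fieldMeasure P j G)) := by
    rw [hμρ, withDensity_apply _ MeasurableSet.univ, Measure.restrict_univ, ofReal_integral_eq_lintegral_ofReal hρ' (Filter.Eventually.of_forall hρ'0)]
  calc μρ.map (fun U : GaugeField P j G => (fun c' => if c' ∈ ({c} : Finset (PBond P (j + 1))) then avgFun ℰ U c' else axialAvg U c' : GaugeField P (j + 1) G))
      = ((μρ.map (fun U : GaugeField P j G =>
          (fun c' => if c' ∈ ({c} : Finset (PBond P (j + 1))) then avgFun ℰ U c' else axialAvg U c' : GaugeField P (j + 1) G))).map (FibreSplit.splitEquiv _ (P := P) (G := G))).map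
          (FibreSplit.splitEquiv _ (P := P) (G := G)).symm := (MeasurableEquiv.map_symm_map _).symm
    _ = ((μρ Set.univ • fieldMeasure P (j + 1) G).map (FibreSplit.splitEquiv _ (P := P) (G := G))).map (FibreSplit.splitEquiv _ (P := P) (G := G)).symm := by rw [himage]
    _ = μρ Set.univ • fieldMeasure P (j + 1) G := MeasurableEquiv.map_symm_map _
    _ = _ := by rw [hmass]

/-- ★★ **THE ISOLATED GUARD OF PRINT'S REFERENCE MEASURE IS INVISIBLE AFTER ONE STEP** (`ρ ≡ 1`): below the top level, `(dU↾G_c)∘(Ū^{{c}})⁻¹ = dU(G_c) • dV` — the singleton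
summand of part 34's positive polymer bound for `μ = dU` is a constant multiple of `dV`. [cite: Balaban1987RG1, (2.1) p.265 + (0.4) p.253; Balaban1985Averaging, (11)+(15) p.19 (bookkeeping — NOT in print)] -/
theorem map_restrict_guard_hybrid_singleton (hlt : j + 1 < P.m + P.K) (hE : ∀ n, Measurable fun W : Fin (n + 1) → G => ℰ.E W) (c : PBond P (j + 1)) :
    ((fieldMeasure P j G).restrict {W : GaugeField P j G | ∀ c' ∈ ({c} : Finset (PBond P (j + 1))), Small ℰ W c'}).map
        (fun U => (fun c' => if c' ∈ ({c} : Finset (PBond P (j + 1))) then avgFun ℰ U c' else axialAvg U c' : GaugeField P (j + 1) G)) =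
      fieldMeasure P j G {W : GaugeField P j G | ∀ c' ∈ ({c} : Finset (PBond P (j + 1))), Small ℰ W c'} • fieldMeasure P (j + 1) G := by
  have hG := measurableSet_guardAll ℰ (P := P) (j := j) (G := G) ({c} : Finset (PBond P (j + 1)))
  have h := map_withDensity_guard_hybrid_singleton_eq_smul ℰ hlt hE c (fun _ => (1 : ℝ)) measurable_const (fun _ => zero_le_one) (integrable_const 1) (fun _ _ => rfl)
    (fun _ _ _ => rfl)
  have hfun : (fun U : GaugeField P j G => ENNReal.ofReal
      ((1 : ℝ) * {W : GaugeField P j G | ∀ c' ∈ ({c} : Finset (PBond P (j + 1))), Small ℰ W c'}.indicator (fun _ => (1 : ℝ)) U)) =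
      {W : GaugeField P j G | ∀ c' ∈ ({c} : Finset (PBond P (j + 1))), Small ℰ W c'}.indicator (1 : GaugeField P j G → ℝ≥0∞) := by
    funext U
    by_cases hU : U ∈ {W : GaugeField P j G | ∀ c' ∈ ({c} : Finset (PBond P (j + 1))), Small ℰ W c'}
    · rw [Set.indicator_of_mem hU, Set.indicator_of_mem hU, one_mul, ENNReal.ofReal_one, Pi.one_apply]
    · rw [Set.indicator_of_notMem hU, Set.indicator_of_notMem hU, mul_zero, ENNReal.ofReal_zero]
  have hdens : ((fieldMeasure P j G).withDensity fun U => ENNReal.ofReal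
      ((1 : ℝ) * {W : GaugeField P j G | ∀ c' ∈ ({c} : Finset (PBond P (j + 1))), Small ℰ W c'}.indicator (fun _ => (1 : ℝ)) U)) =
      (fieldMeasure P j G).restrict {W : GaugeField P j G | ∀ c' ∈ ({c} : Finset (PBond P (j + 1))), Small ℰ W c'} := by
    rw [hfun, withDensity_indicator_one hG]
  have hmass : ENNReal.ofReal (∫ U, (1 : ℝ) * {W : GaugeField P j G | ∀ c' ∈ ({c} : Finset (PBond P (j + 1))), Small ℰ W c'}.indicator (fun _ => (1 : ℝ)) U
      ∂(fieldMeasure P j G)) = fieldMeasure P j G {W : GaugeField P j G | ∀ c' ∈ ({c} : Finset (PBond P (j + 1))), Small ℰ W c'} := by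
    simp_rw [one_mul]
    rw [integral_indicator hG, setIntegral_const, smul_eq_mul, mul_one, measureReal_def, ENNReal.ofReal_toReal (measure_ne_top _ _)]
  rw [hdens, hmass] at h
  exact h

end Isolated

/-! ## §3 At the [B10] slot's averaging `avOfPrint N S₀ j` on `SU(N)` -/

section Slot

open Literature.MathematicalPhysics.QuantumFieldTheory.Balaban1985CMP102.Setting (Scales)
open Literature.MathematicalPhysics.QuantumFieldTheory.Balaban1983to89.ExpMeanLog (expMeanLogSU measurable_expMeanLogSU_E)
open Literature.MathematicalPhysics.QuantumFieldTheory.Balaban1983to89.Node00 (SU)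

variable (N : ℕ) [NeZero N] {L : ℕ}

/-- ★★★ **AT THE SLOT: AN ISOLATED GUARDED BOND OF PRINT'S AVERAGING ON `SU(N)` LEAVES NO TRACE** (every `N`, `j + 1 < m + K`): for every gauge-invariant non-negative measurable
integrable density `ρ` reading only `B(c₋) ∪ B(c₊)`, `((ρ·1_{G_c})·dU)∘(Ū^{{c}})⁻¹ = (∫ ρ·1_{G_c} dU) • dV`. [cite: Balaban1985UV3, (2) p.256; Balaban1987RG1, (2.1) p.265 + (0.4) p.253 (bookkeeping)] -/
theorem map_withDensity_guard_hybrid_singleton_avOfPrint_eq_smul (S₀ : Scales L) {j : ℕ} (hlt : j + 1 < S₀.P.m + S₀.P.K) [DecidableEq (PBond S₀.P (j + 1))]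
    (c : PBond S₀.P (j + 1)) (ρ : Density S₀.P j (SU N)) (hρm : Measurable ρ) (hρ0 : ∀ W, 0 ≤ ρ W) (hρ : Integrable ρ (fieldMeasure S₀.P j (SU N)))
    (hρinv : GaugeField.GaugeInvariant ρ)
    (hloc : ∀ W W' : GaugeField S₀.P j (SU N),
      (∀ b : PBond S₀.P j, blockOf b.src ∈ ({c} : Finset (PBond S₀.P (j + 1))).image PBond.src ∪ ({c} : Finset (PBond S₀.P (j + 1))).image PBond.tgt → W b = W' b) →
        ρ W = ρ W') :
    ((fieldMeasure S₀.P j (SU N)).withDensity fun U => ENNReal.ofReal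
        (ρ U * {W : GaugeField S₀.P j (SU N) | ∀ c' ∈ ({c} : Finset (PBond S₀.P (j + 1))), Small (expMeanLogSU : LoopAverage (SU N)) W c'}.indicator
          (fun _ => (1 : ℝ)) U)).map
        (fun U => (fun c' => if c' ∈ ({c} : Finset (PBond S₀.P (j + 1))) then avgFun (expMeanLogSU : LoopAverage (SU N)) U c' else axialAvg U c' :
          GaugeField S₀.P (j + 1) (SU N))) =
      ENNReal.ofReal (∫ U, ρ U * {W : GaugeField S₀.P j (SU N) | ∀ c' ∈ ({c} : Finset (PBond S₀.P (j + 1))),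
          Small (expMeanLogSU : LoopAverage (SU N)) W c'}.indicator (fun _ => (1 : ℝ)) U ∂(fieldMeasure S₀.P j (SU N))) • fieldMeasure S₀.P (j + 1) (SU N) :=
  map_withDensity_guard_hybrid_singleton_eq_smul (expMeanLogSU : LoopAverage (SU N)) hlt measurable_expMeanLogSU_E c ρ hρm hρ0 hρ hρinv hloc

/-- ★★ **AT THE SLOT, `ρ ≡ 1`**: `(dU↾G_c)∘(Ū^{{c}})⁻¹ = dU(G_c) • dV` for print's averaging on `SU(N)`, every `N`, `j + 1 < m + K`. [cite: Balaban1985UV3, (2) p.256; Balaban1987RG1, (0.4) p.253 (bookkeeping)] -/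
theorem map_restrict_guard_hybrid_singleton_avOfPrint (S₀ : Scales L) {j : ℕ} (hlt : j + 1 < S₀.P.m + S₀.P.K) [DecidableEq (PBond S₀.P (j + 1))]
    (c : PBond S₀.P (j + 1)) :
    ((fieldMeasure S₀.P j (SU N)).restrict {W : GaugeField S₀.P j (SU N) | ∀ c' ∈ ({c} : Finset (PBond S₀.P (j + 1))), Small (expMeanLogSU : LoopAverage (SU N)) W c'}).map
        (fun U => (fun c' => if c' ∈ ({c} : Finset (PBond S₀.P (j + 1))) then avgFun (expMeanLogSU : LoopAverage (SU N)) U c' else axialAvg U c' :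
          GaugeField S₀.P (j + 1) (SU N))) =
      fieldMeasure S₀.P j (SU N) {W : GaugeField S₀.P j (SU N) | ∀ c' ∈ ({c} : Finset (PBond S₀.P (j + 1))), Small (expMeanLogSU : LoopAverage (SU N)) W c'} •
        fieldMeasure S₀.P (j + 1) (SU N) :=
  map_restrict_guard_hybrid_singleton (expMeanLogSU : LoopAverage (SU N)) hlt measurable_expMeanLogSU_E c

end Slot

end Summit.QuantumFields.YangMills.BalabanUVNodes.N08HaarCompatibilityGuardHybridIsolatedGuard

end
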